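import Summits.Langlands.Langlands.Theorems.ProModularOrdinaryClassical.Negative.PointsIntegral
import Summits.Langlands.Langlands.Theorems.EisensteinProModularSeed.Negative.BorelAndEisenstein

/-!
# `ProModularOrdinaryClassical` (stmt-Langlands-12921) — Negative knowledge III: Frobenius data of a
# pro-modular `ρ` are integral; the Eisenstein Hecke–Frobenius polynomial

From the standing disprover's `Cruxes/ProModularOrdinaryClassical/Disproof.lean` (cdisprove gen 2,
cycle 2, §5–§6). Consequences, at the crux's types, of the integrality of continuous `ℚ̄_p`-points of
`𝕋(𝒰)` (`Negative/PointsIntegral.lean`) combined with the seed disprover's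
`trace_det_frob_of_isAssociated`:

* `hpm_point_integral` — the crux's hypothesis H3 `∃ 𝒰, 𝒰.IsPadicallyAutomorphic ρ` yields a tame
  level and a continuous eigensystem `x : 𝕋(𝒰) → ℚ̄_p` associated with `ρ` with `‖x t‖ ≤ 1` for all `t`;
* `norm_trace_det_frob_le_one` — for a `p`-adically automorphic `ρ : Γ_F → GL₂(ℚ̄_p)`, at every good
  place `v ∉ 𝒰.bad` and every arithmetic Frobenius `σ` above `v`: `‖tr ρ(σ)‖ ≤ 1`, `‖det ρ(σ)‖ ≤ 1`
  (forced on the Hecke side alone: no non-integral point of `𝕋(𝒰)` is associated with anything);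
* `heckeFrobPoly_two_eisenstein` — at the degree-`0` (Eisenstein) eigensystem `(q+1, 1)` the
  polynomial of `IsAssociated` is `(X - 1)(X - q)`, the arithmetic-Frobenius characteristic polynomial
  of `1 ⊕ ε` (`ε(Frob_v) = q_v`): the normalisation behind "irreducibility fences off the `H⁰` points";
* the same bookkeeping for the ORDINARY / Hida-tower notions every surviving line of the crux uses
  (`IsOrdinarilyPadicallyAutomorphic`, `IsIwahoriPadicallyAutomorphic`): `trace_det_frob_of_isAssociatedFamily`
  (any eigensystem family), `eventually_isUnramifiedAt_of_isOrdinarilyPadicallyAutomorphic` (the a.e.-unramified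
  hypothesis of `OrdinaryPointsClassical` is decoration, as for the crux), `ord_point_integral`,
  `norm_trace_det_frob_le_one_of_isOrdinarilyPadicallyAutomorphic`.

[folklore]
-/

set_option linter.dupNamespace false

namespace Summit.Langlands.Langlands.Theorems.ProModularOrdinaryClassical.Negative

open Summit.Langlands.Langlands.Theorems.EisensteinProModularSeed.Negative
  (trace_det_frob_of_isAssociated trace_det_of_charpoly_eq_heckeFrobPoly)
open Summit.Langlands.Langlands.Theorems.ReducibleOrdinaryProModular.Negative (heckeFrobPoly_two)
open Literature.NumberTheory.Automorphic Literature.NumberTheory.GaloisRepresentations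
open Literature.NumberTheory.Automorphic.BigHeckeGLn
open NumberField IsDedekindDomain Polynomial

variable {F : Type} [Field F] [NumberField F] {p : ℕ} [Fact p.Prime]

/-- **H3 yields an INTEGRAL continuous eigensystem**: from `∃ 𝒰, 𝒰.IsPadicallyAutomorphic ρ` one
gets a tame level, a continuous `x : 𝕋(𝒰) → ℚ̄_p` associated with `ρ`, and `‖x t‖ ≤ 1` for every
`t ∈ 𝕋(𝒰)`. Any rank `n`. [folklore] -/
theorem hpm_point_integral {n : ℕ} {ρ : FramedGaloisRep F (PadicAlgCl p) n}
    (hpm : ∃ 𝒰 : TameLevel n F p, 𝒰.IsPadicallyAutomorphic ρ) :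
    ∃ (𝒰 : TameLevel n F p) (x : CompletedCohomologyHeckeAlgebraGLn 𝒰 →+* PadicAlgCl p),
      Continuous x ∧ 𝒰.IsAssociated x ρ ∧ ∀ t, ‖x t‖ ≤ 1 := by
  obtain ⟨𝒰, x, hx, hass⟩ := hpm
  exact ⟨𝒰, x, hx, hass, norm_apply_le_one_of_continuous 𝒰 x hx⟩

/-- **Frobenius traces and determinants of a pro-modular `ρ` are integral**: if `ρ : Γ_F → GL₂(ℚ̄_p)`
is `p`-adically automorphic of tame level `𝒰`, then at every good place `v ∉ 𝒰.bad` and every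
arithmetic Frobenius `σ` at a prime above `v`, `‖tr ρ(σ)‖ ≤ 1` and `‖det ρ(σ)‖ ≤ 1`
(`tr = x(T_{v,1})`, `det = q_v x(T_{v,2})`, integrality of `x`, `‖q_v‖ ≤ 1`). [folklore] -/
theorem norm_trace_det_frob_le_one {𝒰 : TameLevel 2 F p} {ρ : FramedGaloisRep F (PadicAlgCl p) 2}
    (h : 𝒰.IsPadicallyAutomorphic ρ) {v : HeightOneSpectrum (𝓞 F)} (hv : v ∉ 𝒰.bad)
    {𝔓 : Ideal (absIntegers (𝓞 F) F)} (h𝔓 : 𝔓 ∈ v.primesAbove) {σ : Field.absoluteGaloisGroup F}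
    (hσ : IsArithFrobAt (𝓞 F) σ 𝔓) :
    ‖(ρ σ).val.trace‖ ≤ 1 ∧ ‖(ρ σ).val.det‖ ≤ 1 := by
  obtain ⟨x, hx, hass⟩ := h
  obtain ⟨htr, hdet⟩ := trace_det_frob_of_isAssociated hass hv h𝔓 hσ
  refine ⟨?_, ?_⟩
  · rw [htr]
    exact norm_apply_le_one_of_continuous 𝒰 x hx _
  · rw [hdet, norm_mul]
    exact mul_le_one₀ (IsUltrametricDist.norm_natCast_le_one (PadicAlgCl p) _) (norm_nonneg _)
      (norm_apply_le_one_of_continuous 𝒰 x hx _)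

omit [NumberField F] [Fact p.Prime] in
/-- **The Eisenstein Hecke–Frobenius polynomial.** At the degree-`0` eigensystem `T_{v,1} ↦ q_v + 1`,
`T_{v,2} ↦ 1`, the polynomial of `IsAssociated` is `X² − (q+1)X + q = (X − 1)(X − q)`: the
characteristic polynomial of the ARITHMETIC Frobenius on `1 ⊕ ε`. [folklore] -/
theorem heckeFrobPoly_two_eisenstein {R : Type*} [CommRing R] (q : ℕ) (a : ℕ → R)
    (h1 : a 1 = q + 1) (h2 : a 2 = 1) :
    heckeFrobPoly 2 q a = (X - 1) * (X - C (q : R)) := by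
  rw [heckeFrobPoly_two, h1, h2, mul_one, C_add, C_1, map_natCast]
  ring


/-! ### The same bookkeeping for eigensystem families and for Hida's ordinary points -/

omit [Fact p.Prime] in
/-- **Any association pins trace and determinant of Frobenius**: if `ρ : Γ_F → GL₂(A)` is associated
with the eigensystem family `a` outside `S` (`IsAssociatedFamily`), then at `v ∉ S` and every arithmetic
Frobenius `σ` above `v`, `tr ρ(σ) = a_v(1)` and `det ρ(σ) = q_v a_v(2)`. [folklore] -/
theorem trace_det_frob_of_isAssociatedFamily {A : Type*} [CommRing A] [Nontrivial A] [TopologicalSpace A]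
    {S : Set (HeightOneSpectrum (𝓞 F))} {a : HeightOneSpectrum (𝓞 F) → ℕ → A}
    {ρ : FramedGaloisRep F A 2} (h : IsAssociatedFamily 2 S a ρ)
    {v : HeightOneSpectrum (𝓞 F)} (hv : v ∉ S) {𝔓 : Ideal (absIntegers (𝓞 F) F)}
    (h𝔓 : 𝔓 ∈ v.primesAbove) {σ : Field.absoluteGaloisGroup F} (hσ : IsArithFrobAt (𝓞 F) σ 𝔓) :
    (ρ σ).val.trace = a v 1 ∧ (ρ σ).val.det = (Ideal.absNorm v.asIdeal : A) * a v 2 :=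
  trace_det_of_charpoly_eq_heckeFrobPoly _ _ _ ((h v hv).2 𝔓 h𝔓 σ hσ)

/-- **Ordinarily pro-modular ⇒ unramified almost everywhere** (`IsOrdAssociated` forces unramifiedness
off the finite `𝒰.bad`): the a.e.-unramified hypothesis of the presumptive stub `OrdinaryPointsClassical`
is decoration, exactly as `hunr` is for the crux. Any rank, any coefficients. [folklore] -/
theorem eventually_isUnramifiedAt_of_isOrdinarilyPadicallyAutomorphic {n : ℕ} (𝒰 : TameLevel n F p)
    {A : Type*} [CommRing A] [TopologicalSpace A] {ρ : FramedGaloisRep F A n}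
    (h : 𝒰.IsOrdinarilyPadicallyAutomorphic ρ) : ∀ᶠ v in Filter.cofinite, ρ.IsUnramifiedAt v := by
  obtain ⟨x, -, hx⟩ := h
  refine Filter.eventually_cofinite.2 (𝒰.bad_finite.subset fun v hv => ?_)
  by_contra hvb
  exact hv (hx v hvb).1

/-- Same for the Hida-tower notion `IsIwahoriPadicallyAutomorphic`. [folklore] -/
theorem eventually_isUnramifiedAt_of_isIwahoriPadicallyAutomorphic {n : ℕ} (𝒰 : TameLevel n F p)
    {A : Type*} [CommRing A] [TopologicalSpace A] {ρ : FramedGaloisRep F A n}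
    (h : 𝒰.IsIwahoriPadicallyAutomorphic ρ) : ∀ᶠ v in Filter.cofinite, ρ.IsUnramifiedAt v := by
  obtain ⟨x, -, hx⟩ := h
  refine Filter.eventually_cofinite.2 (𝒰.bad_finite.subset fun v hv => ?_)
  by_contra hvb
  exact hv (hx v hvb).1

/-- **Hida's ordinary points are integral too**: `IsOrdinarilyPadicallyAutomorphic ρ` yields a continuous
`x : 𝕋^{S,ord}(𝒰) → ℚ̄_p` associated with `ρ` and `‖x t‖ ≤ 1` for all `t`
(`norm_apply_le_one_of_continuous_ord`). [folklore] -/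
theorem ord_point_integral {n : ℕ} (𝒰 : TameLevel n F p) {ρ : FramedGaloisRep F (PadicAlgCl p) n}
    (h : 𝒰.IsOrdinarilyPadicallyAutomorphic ρ) :
    ∃ x : OrdinaryHeckeAlgebraGLn 𝒰 →+* PadicAlgCl p,
      Continuous x ∧ 𝒰.IsOrdAssociated x ρ ∧ ∀ t, ‖x t‖ ≤ 1 := by
  obtain ⟨x, hx, hass⟩ := h
  exact ⟨x, hx, hass, norm_apply_le_one_of_continuous_ord 𝒰 x hx⟩

/-- **Frobenius traces and determinants of an ordinarily pro-modular `ρ` are integral** at every good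
place (hypothesis of `OrdinaryPointsClassical` / conclusion of `OrdinaryFactorisation`). [folklore] -/
theorem norm_trace_det_frob_le_one_of_isOrdinarilyPadicallyAutomorphic {𝒰 : TameLevel 2 F p}
    {ρ : FramedGaloisRep F (PadicAlgCl p) 2} (h : 𝒰.IsOrdinarilyPadicallyAutomorphic ρ)
    {v : HeightOneSpectrum (𝓞 F)} (hv : v ∉ 𝒰.bad) {𝔓 : Ideal (absIntegers (𝓞 F) F)}
    (h𝔓 : 𝔓 ∈ v.primesAbove) {σ : Field.absoluteGaloisGroup F} (hσ : IsArithFrobAt (𝓞 F) σ 𝔓) :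
    ‖(ρ σ).val.trace‖ ≤ 1 ∧ ‖(ρ σ).val.det‖ ≤ 1 := by
  obtain ⟨x, hx, hass⟩ := h
  obtain ⟨htr, hdet⟩ := trace_det_frob_of_isAssociatedFamily hass hv h𝔓 hσ
  refine ⟨?_, ?_⟩
  · rw [htr]
    exact norm_apply_le_one_of_continuous_ord 𝒰 x hx _
  · rw [hdet, norm_mul]
    exact mul_le_one₀ (IsUltrametricDist.norm_natCast_le_one (PadicAlgCl p) _) (norm_nonneg _)
      (norm_apply_le_one_of_continuous_ord 𝒰 x hx _)

end Summit.Langlands.Langlands.Theorems.ProModularOrdinaryClassical.Negative
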